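import Literature.AlgebraicGeometry.Frobenioids.TwinPrimaryTransport
import Literature.AlgebraicGeometry.Frobenioids.TwinPrimarySquaresWeak
import HarnessLib

/-!
# [FrdI] Theorem 4.9, sub-DAG row T49-L08 («Ψ preserves twin-primary data»), proof p. 90 ll. 28–54, for
# WEAKLY perf-factorial `Φ_i` — weak twin of `TwinPrimaryTransport.lean`

Mochizuki, *The geometry of Frobenioids I: the general theory*, Kyushu J. Math. **62** (2008)
293–400, §4, proof of Theorem 4.9, kurims text p. 90 ll. 28–54 [cite: MochizukiFrdI2008, Thm. 4.9 p.90]: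
"… since `Ψ` preserves pre-steps, primary steps …, Div-equivalent pairs of base-isomorphisms …, and
cartesian diagrams of pre-steps as in Proposition 4.1, (iii), we thus conclude that `Ψ` maps the pair of
twin-primary steps `(α, β)` to a pair of twin-primary steps of `C₂`".

PROOF-ONLY weak twin of `FrdI.T49.isTwinPrimary_map_of_coprimary_squares` (seat abc-iut-w4-d105): the SAME
statement with the frozen hypothesis structure `FrdI.T42.Setting F₁ F₂ Ψ` (whose fields `perfFactorialᵢ`
carry Def. 2.4 (i) (a)–(d) as printed) REPLACED by the clauses its proof uses, as EXPLICIT BINDERS —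
`C_i` Frobenioids of perfect and isotropic type, `Φ_i` WEAKLY perf-factorial (`IsPerfFactorialWeak`,
`PerfFactorialWeak.lean`: (a)–(c) verbatim + (d_ord), (d_res); cell finding F-L2d2-1), `Ψ`/`Ψ⁻¹` preserve
pre-steps, `Ψ` preserves steps (convention Σ2 of the weak lineage, seat abc-iut-L1-t12's `Cor411ii*Weak`:
no twin of the frozen `Setting` is declared). Proof verbatim over
`PreFrobenioid.div_eq_invDiv_of_coprimary_squares_weak` (`TwinPrimarySquaresWeak.lean`) and the
hypothesis-free transports `PreFrobenioid.cartesian_map` / `coprimary_map`; (d) itself is never used. The printed (strong) case: instantiate the binders with the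
fields of a `T42.Setting` and `(S.perfFactorialᵢ X).weak`. Cell abc-iut, layer L1, seat abc-iut-L1-t11
(block T1 of the [FrdI] Thm. 4.9 / Cor. 4.11 (iii)(iv) weak programme, split with seat abc-iut-L1-t14).
`IsTwinPrimary` is the typed notion of `Thm49Sub.lean` (seat abc-iut-L1-t14), unchanged. No new definitions;
nothing printed is restated as if corrected; nothing here bears on [IUTchIII] Cor. 3.12.
-/

namespace Literature.AlgebraicGeometry.Frobenioids

open CategoryTheory Opposite

namespace FrdI.T49

universe w v v' u u'

-- the `(F ⋙ G).obj X` / `G.obj (F.obj X)` bookkeeping under `Ψ` (as in the tree's `Equivalence*.lean`)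
set_option backward.isDefEq.respectTransparency false

variable {D₁ : Type u} [Category.{v} D₁] {Φ₁ : D₁ᵒᵖ ⥤ CommMonCat.{w}} {C₁ : Type u'} [Category.{v'} C₁]
  {D₂ : Type u} [Category.{v} D₂] {Φ₂ : D₂ᵒᵖ ⥤ CommMonCat.{w}} {C₂ : Type u'} [Category.{v'} C₂]

/-- **T49-L08 with print's co-primarity ("as in Proposition 4.1, (iii)")**: for Frobenioids of perfect
and isotropic type with `Φ_i` WEAKLY perf-factorial and `Ψ`, `Ψ⁻¹` preserving pre-steps, `Ψ` preserving
steps (the clauses of `FrdI.T42.Setting` that the proof uses, as explicit binders), with `Ψ` preserving primary steps [Thm. 4.2 (i)] and Div-equivalent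
pairs of base-isomorphisms [Thm. 4.2 (ii)], let `α : A → F`, `β : B → A` be primary steps and
`γ, γ', δ, γ'', δ'` pre-steps forming commutative squares `δ ∘ γ' = β ∘ γ` (over `A`) and
`δ' ∘ γ' = α ∘ γ''` (over `F`), each cartesian among pre-steps, with `(δ, β)` and `(δ', α)` co-primary,
and `ζ := β ∘ γ`, `γ''` Div-equivalent. Then `α`, `β` are twin-primary AND `Ψ α`, `Ψ β` are
twin-primary ([FrdI] p. 90 ll. 28–54). [cite: MochizukiFrdI2008, Thm. 4.9 p.90] -/
theorem isTwinPrimary_map_of_coprimary_squares_weak (F₁ : C₁ ⥤ ElemFrobenioid Φ₁)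
    (F₂ : C₂ ⥤ ElemFrobenioid Φ₂) (Ψ : C₁ ≌ C₂)
    (hF₁ : PreFrobenioid.IsFrobenioid F₁) (hF₂ : PreFrobenioid.IsFrobenioid F₂)
    (hperf₁ : PreFrobenioid.IsOfPerfectType F₁) (hperf₂ : PreFrobenioid.IsOfPerfectType F₂)
    (histr₁ : PreFrobenioid.IsOfIsotropicType F₁) (histr₂ : PreFrobenioid.IsOfIsotropicType F₂)
    (hpf₁ : Objectwise (fun M _ => IsPerfFactorialWeak M) Φ₁)
    (hpf₂ : Objectwise (fun M _ => IsPerfFactorialWeak M) Φ₂)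
    (hpre : ∀ ⦃X Y : C₁⦄ (φ : X ⟶ Y),
      PreFrobenioid.IsPreStep F₁ φ → PreFrobenioid.IsPreStep F₂ (Ψ.functor.map φ))
    (hpre' : ∀ ⦃X Y : C₂⦄ (φ : X ⟶ Y),
      PreFrobenioid.IsPreStep F₂ φ → PreFrobenioid.IsPreStep F₁ (Ψ.inverse.map φ))
    (hstep : ∀ ⦃X Y : C₁⦄ (φ : X ⟶ Y),
      PreFrobenioid.IsStep F₁ φ → PreFrobenioid.IsStep F₂ (Ψ.functor.map φ))
    (hprim : ∀ ⦃X Y : C₁⦄ (φ : X ⟶ Y), PreFrobenioid.IsPrimaryPreStep F₁ φ →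
      PreFrobenioid.IsPrimaryPreStep F₂ (Ψ.functor.map φ))
    (hdiveq : ∀ ⦃X Y : C₁⦄ (φ ψ : X ⟶ Y), PreFrobenioid.IsBaseIso F₁ φ → PreFrobenioid.IsBaseIso F₁ ψ →
      PreFrobenioid.DivEquivalent F₁ φ ψ →
        PreFrobenioid.DivEquivalent F₂ (Ψ.functor.map φ) (Ψ.functor.map ψ))
    {A B C' D' F' : C₁} (α : A ⟶ F') (β : B ⟶ A) (γ : C' ⟶ B) (γ' : C' ⟶ D') (δ : D' ⟶ A)
    (γ'' : C' ⟶ A) (δ' : D' ⟶ F')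
    (hα : PreFrobenioid.IsStep F₁ α) (hαp : PreFrobenioid.IsPrimaryPreStep F₁ α)
    (hβ : PreFrobenioid.IsStep F₁ β) (hβp : PreFrobenioid.IsPrimaryPreStep F₁ β)
    (hγ : PreFrobenioid.IsPreStep F₁ γ) (hγ' : PreFrobenioid.IsPreStep F₁ γ')
    (hδ : PreFrobenioid.IsPreStep F₁ δ) (hγ'' : PreFrobenioid.IsPreStep F₁ γ'')
    (hδ' : PreFrobenioid.IsPreStep F₁ δ')
    (sq₁ : γ' ≫ δ = γ ≫ β) (sq₂ : γ' ≫ δ' = γ'' ≫ α)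
    (cart₁ : ∀ ⦃V : C₁⦄ (a : V ⟶ D') (b : V ⟶ B), PreFrobenioid.IsPreStep F₁ a →
      PreFrobenioid.IsPreStep F₁ b → a ≫ δ = b ≫ β → ∃! u : V ⟶ C', u ≫ γ' = a ∧ u ≫ γ = b)
    (cart₂ : ∀ ⦃V : C₁⦄ (a : V ⟶ D') (b : V ⟶ A), PreFrobenioid.IsPreStep F₁ a →
      PreFrobenioid.IsPreStep F₁ b → a ≫ δ' = b ≫ α → ∃! u : V ⟶ C', u ≫ γ' = a ∧ u ≫ γ'' = b)
    (cop₁ : ∀ ⦃Z : C₁⦄ (ζ : Z ⟶ A), PreFrobenioid.IsPreStep F₁ ζ →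
      (∃ (ε' : D' ⟶ Z) (ι' : B ⟶ Z), PreFrobenioid.IsPreStep F₁ ε' ∧ PreFrobenioid.IsPreStep F₁ ι' ∧
          ε' ≫ ζ = δ ∧ ι' ≫ ζ = β) → IsIso ζ)
    (cop₂ : ∀ ⦃Z : C₁⦄ (ζ : Z ⟶ F'), PreFrobenioid.IsPreStep F₁ ζ →
      (∃ (ε' : D' ⟶ Z) (ι' : A ⟶ Z), PreFrobenioid.IsPreStep F₁ ε' ∧ PreFrobenioid.IsPreStep F₁ ι' ∧
          ε' ≫ ζ = δ' ∧ ι' ≫ ζ = α) → IsIso ζ)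
    (hde : PreFrobenioid.DivEquivalent F₁ (γ ≫ β) γ'') :
    IsTwinPrimary F₁ α β ∧ IsTwinPrimary F₂ (Ψ.functor.map α) (Ψ.functor.map β) := by
  refine ⟨⟨hα, hαp, hβ, hβp, fun h => ?_⟩,
    ⟨hstep α hα, hprim α hαp, hstep β hβ, hprim β hβp, fun h => ?_⟩⟩
  · -- one Frobenioid: the computation over the co-primary squares of `C₁`
    exact PreFrobenioid.div_eq_invDiv_of_coprimary_squares_weak F₁ hF₁ hperf₁ histr₁
      hpf₁ α β γ γ' δ γ'' δ' hα.1 hβ.1 hγ hγ' hδ hγ'' hδ' sq₁ sq₂ cart₁ cart₂ cop₁ cop₂ hde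
  · -- the image squares in `C₂`: commutative, cartesian among pre-steps, over co-primary pairs
    have sq₁' : Ψ.functor.map γ' ≫ Ψ.functor.map δ = Ψ.functor.map γ ≫ Ψ.functor.map β := by
      rw [← Ψ.functor.map_comp, sq₁, Ψ.functor.map_comp]
    have sq₂' : Ψ.functor.map γ' ≫ Ψ.functor.map δ' = Ψ.functor.map γ'' ≫ Ψ.functor.map α := by
      rw [← Ψ.functor.map_comp, sq₂, Ψ.functor.map_comp]
    have hde' : PreFrobenioid.DivEquivalent F₂ (Ψ.functor.map γ ≫ Ψ.functor.map β)
        (Ψ.functor.map γ'') := by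
      rw [← Ψ.functor.map_comp]
      exact hdiveq _ _ (PreFrobenioid.IsPreStep.comp F₁ hγ hβ.1).2 hγ''.2 hde
    exact PreFrobenioid.div_eq_invDiv_of_coprimary_squares_weak F₂ hF₂ hperf₂
      histr₂ hpf₂ _ _ _ _ _ _ _ (hpre α hα.1) (hpre β hβ.1)
      (hpre γ hγ) (hpre γ' hγ') (hpre δ hδ) (hpre γ'' hγ'')
      (hpre δ' hδ') sq₁' sq₂' (PreFrobenioid.cartesian_map Ψ hpre' cart₁)
      (PreFrobenioid.cartesian_map Ψ hpre' cart₂) (PreFrobenioid.coprimary_map Ψ hpre' cop₁)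
      (PreFrobenioid.coprimary_map Ψ hpre' cop₂) hde'

end FrdI.T49

end Literature.AlgebraicGeometry.Frobenioids
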